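import Literature.MathematicalPhysics.QuantumLattice.InfiniteVolumeChainTwistProofs
import Mathlib.Topology.Algebra.Module.FiniteDimension
import Mathlib.Topology.Order.IntermediateValue
import HarnessLib

/-!
# Discharge of `no_unique_gapped_groundState_halfOddSpin`: the Affleck–Lieb theorem

Trunk **T-QLATTICE**, family `hubbard`, statement **hubbard.S23**. Final proof file behind the
named fact `Literature.MathematicalPhysics.QuantumLattice.no_unique_gapped_groundState_halfOddSpin`
of `InfiniteVolume.lean` (Affleck–Lieb 1986; Tasaki 2022, Cor. 3.6): *for half-odd-integer spin
`S = n/2` (`n` odd) and any coupling `J`, if the Heisenberg chain `H = J Σ_x 𝐒_x·𝐒_{x+1}` has a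
unique infinite-volume ground state `ω`, then `ω` is not a gapped ground state* (local
Bratteli–Robinson criteria of `InfiniteVolumeStates`, Tasaki 2022 Def. 2.2 / 2.5).

## The proof (Tasaki 2022 §3, with the `ℤ₂` symmetry in place of the winding number)

Suppose `ω` is the unique ground state and is gapped with gap `γ > 0`. Uniqueness makes `ω`
translation invariant (`InfiniteVolumeShiftProofs`) and invariant under the spin flip, the
`π`-rotation about the `x`-axis (`InfiniteVolumeFlipProofs`) — "the (global) uniqueness implies
that the ground state is invariant under translation … and `ω(Ŝᶻ) = 0`" (Tasaki 2022, before
Cor. 3.6). On the block `Λ_ℓ = {1,…,ℓ}` consider the local twist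
`Û_ℓ = exp[-i Σ_{x=1}^{ℓ} (2πx/ℓ)(Ŝᶻ_x + S)]` and the uniform rotations
`Ŵ_α = exp[-iα Σ_{x=1}^{ℓ}(Ŝᶻ_x + S)]` (`SpinFlipTwist`).

1. *Variational estimate + gap* (Tasaki 2022, Lemma 3.1 and Lemma 3.2;
   `InfiniteVolumeChainEnergyProofs`, `InfiniteVolumeChainTwistProofs`): with
   `K = |J| |c₀| (ℓ+2) 4π²/ℓ²` (`c₀` the common transverse bond correlation),
   `γ(1 - |ω(Û_ℓ)|²) ≤ K` and `γ(1 - |ω(Ŵ_α)|²) ≤ K` for `|α| ≤ 2π/ℓ`; for `ℓ` large, `K/γ ≤ 1/4`.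
2. *Twist/translation identity* (proof of Tasaki's Lemma 3.3): `Û_ℓᴴ 𝒯₁(Û_ℓ) = Ŵ_{-2π/ℓ}`, and
   by translation invariance and the near-eigenvector (Cauchy–Schwarz) estimate,
   `re ω(Ŵ_{-2π/ℓ}) ≥ |ω(Û_ℓ)|² - (1 - |ω(Û_ℓ)|²)^{1/2} ≥ 3/4 - 1/2 > 0`.
3. *Flip symmetry*: `g(α) = e^{inℓα/2} ω(Ŵ_α)` is real (`conj_expect_twistW`), continuous, `g(0) = 1`,
   and `g(α)² = |ω(Ŵ_α)|² ≥ 3/4` on `[-2π/ℓ, 0]`; by the intermediate value theorem `g > 0` there,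
   in particular `g(-2π/ℓ) > 0`. But `e^{-inℓ(-2π/ℓ)/2} = e^{iπn} = -1` for odd `n`
   (half-odd-integer spin!), so `ω(Ŵ_{-2π/ℓ}) = -g(-2π/ℓ) < 0`, contradicting step 2.

Step 3 replaces Tasaki's identification of the winding number of `x ↦ ω(Û_{x,ℓ})` with the
filling factor `ν = S` (Lemma 3.3, which needs clustering) by the `ℤ₂` symmetry available for the
Heisenberg chain (Affleck–Lieb's `U(1) ⋊ ℤ₂` setting): the parity `e^{iπn} = e^{2πiS}` is exactly the
obstruction `ν = S ∉ ℤ`. The coupling `J` is arbitrary (for `J = 0` every state is a ground state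
and the estimate holds with `K = 0`).

No statement of `InfiniteVolume` is changed and no definition is introduced.

## References

* I. Affleck, E. H. Lieb, *A proof of part of Haldane's conjecture on spin chains*,
  Lett. Math. Phys. 12 (1986) 57–69 (the theorem: half-odd-integer spin, unique ground state
  ⇒ no gap; infinite-chain formulation, local twist). [AffleckLieb1986]
* H. Tasaki, *The Lieb–Schultz–Mattis theorem. A topological point of view*, in: The Physics
  and Mathematics of Elliott Lieb, vol. 2, EMS Press (2022) 405–446, arXiv:2202.06243 (held):
  Def. 2.2, Def. 2.5, §3.1 Lemma 3.1, Lemma 3.2, §3.2 Lemma 3.3 (proof), Theorem 3.4,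
  Cor. 3.5, **Cor. 3.6 (Affleck–Lieb theorem)**. [Tasaki2022]
* H. Tasaki, J. Stat. Phys. 170 (2018) 653–671, arXiv:1708.05186 (held), Lemmas 1–2,
  Corollary 1b. [Tasaki2018]
* H. Tasaki, *Physics and Mathematics of Quantum Many-Body Systems*, Springer (2020), the cite
  carried by the fact (Thm. 8.5 / App. A.7; not held — the discharge follows Tasaki 2022).
  [Tasaki2020]
-/

noncomputable section

open Matrix Complex Finset
open scoped ComplexOrder

namespace Literature.MathematicalPhysics.QuantumLattice

open Literature.Probability.LatticeModels
open Literature.Probability.LatticeModels (Site)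

/-! ### Continuity of the rotation average -/

/-- The uniform rotation `α ↦ Ŵ_α = exp[-iα Σ_{x∈Λ}(Ŝᶻ_x + S)]` depends continuously on the angle
(entrywise it is `exp(-iα N_σ)` on the diagonal). Tasaki (2022) §3.1 ("the twist operator is
continuous …"). [folklore] -/
theorem continuous_twistW {Λt : Type*} [Fintype Λt] [DecidableEq Λt] {q : ℕ} :
    Continuous fun α : ℝ => (twistOp (fun _ : Λt => α) : Op Λt q) := by
  unfold twistOp twistPhase
  refine Continuous.matrix_diagonal ?_
  refine continuous_pi fun σ => ?_
  fun_prop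

/-- The rotation average `α ↦ ω_Λ(Ŵ_α)` of an infinite-volume state is continuous (a linear
functional on the finite-dimensional local algebra composed with `α ↦ Ŵ_α`). Tasaki (2022) §3.2
("`ω(Û_{x,ℓ})` is continuous in `x`"). [folklore] -/
theorem InfVolState.continuous_expect_twistW {d q : ℕ} (ω : InfVolState d q) (Λ : Finset (Site d)) :
    Continuous fun α : ℝ => ω.expect Λ (twistOp fun _ : ↥Λ => α) :=
  (LinearMap.continuous_of_finiteDimensional (ω.expect Λ)).comp continuous_twistW

/-! ### The parity of half-odd-integer spin -/

/-- The parity obstruction: `e^{iπn} = -1` for odd `n`, i.e. `e^{2πiS} = -1` for half-odd-integer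
spin `S = n/2` (Affleck–Lieb: "an extension is possible only when `S` is a half-odd-integer").
[folklore] -/
theorem exp_pi_mul_I_odd {n : ℕ} (hn : Odd n) : Complex.exp ((n : ℂ) * (Real.pi * I)) = -1 := by
  rw [Complex.exp_nat_mul, Complex.exp_pi_mul_I, hn.neg_one_pow]

/-! ### The Affleck–Lieb theorem -/

/-- **Discharge of `no_unique_gapped_groundState_halfOddSpin` (hubbard.S23): the Affleck–Lieb
theorem.** For the spin-`n/2` Heisenberg chain `H = J Σ_x 𝐒_x·𝐒_{x+1}` with `n` odd and any `J`: if
the infinite-volume ground state is unique, then no ground state is gapped (local gap criterion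
`IsGappedGroundState`). Proof as in the module docstring: uniqueness ⇒ translation and flip
invariance; the variational estimate with the gap makes `|ω(Û_ℓ)|, |ω(Ŵ_α)|` close to `1`
(Tasaki 2022, Lemmas 3.1–3.2); the twist/translation identity `Û_ℓᴴ𝒯₁(Û_ℓ) = Ŵ_{-2π/ℓ}` with
Cauchy–Schwarz forces `re ω(Ŵ_{-2π/ℓ}) > 0`; flip symmetry, Hermiticity and continuity force
`e^{-iπn} ω(Ŵ_{-2π/ℓ}) > 0`, i.e. `ω(Ŵ_{-2π/ℓ}) < 0` for odd `n`. Affleck–Lieb (1986);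
Tasaki (2022) Cor. 3.6 (with Lemmas 3.1–3.3); Tasaki (2020) Thm. 8.5 (cite of the fact).
[cite: Tasaki2022, Cor. 3.6] -/
theorem no_unique_gapped_groundState_halfOddSpin_holds : no_unique_gapped_groundState_halfOddSpin := by
  intro n hn J ω γ hU hω hgap
  have hγ : 0 < γ := hgap.2.1
  -- the common transverse bond correlation and the constant of the variational estimate
  set c₀ := ω.expect {0, 1}
    (spinBond n 0 (⟨0, mem_insert_self 0 {1}⟩ : ↥({0, 1} : Finset (Site 1)))
        ⟨1, mem_insert_of_mem (mem_singleton_self 1)⟩ +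
      spinBond n 1 (⟨0, mem_insert_self 0 {1}⟩ : ↥({0, 1} : Finset (Site 1)))
        ⟨1, mem_insert_of_mem (mem_singleton_self 1)⟩) with hc₀
  set A := |J| * ‖c₀‖ * (4 * Real.pi ^ 2) with hA
  have hA0 : 0 ≤ A := by positivity
  -- choose the block length `ℓ`
  obtain ⟨ℓ, hℓ⟩ := exists_nat_gt (max 1 (12 * A / γ))
  have hℓ1 : 1 ≤ ℓ := by exact_mod_cast ((le_max_left _ _).trans hℓ.le)
  have hℓpos : (0 : ℝ) < ℓ := by exact_mod_cast hℓ1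
  have hℓA : 12 * A / γ < ℓ := (le_max_right _ _).trans_lt hℓ
  -- the constant `K = |J| |c₀| (ℓ+2) 4π²/ℓ²` satisfies `K ≤ γ/4`
  have hK : |J| * ‖c₀‖ * ((ℓ + 2 : ℕ) * (4 * Real.pi ^ 2 / ℓ ^ 2)) ≤ γ / 4 := by
    have h1 : |J| * ‖c₀‖ * ((ℓ + 2 : ℕ) * (4 * Real.pi ^ 2 / ℓ ^ 2)) = A * ((ℓ + 2 : ℕ) / ℓ ^ 2) := by
      rw [hA]; ring
    have h2 : ((ℓ + 2 : ℕ) : ℝ) / ℓ ^ 2 ≤ 3 / ℓ := by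
      rw [div_le_div_iff₀ (by positivity) hℓpos]
      push_cast
      have hℓ1' : (1 : ℝ) ≤ ℓ := by exact_mod_cast hℓ1
      nlinarith [hℓ1']
    have h3 : A * (3 / ℓ) ≤ γ / 4 := by
      rw [div_lt_iff₀ hγ] at hℓA
      rw [mul_div_assoc', div_le_div_iff₀ hℓpos (by norm_num : (0 : ℝ) < 4)]
      nlinarith
    rw [h1]
    exact (mul_le_mul_of_nonneg_left h2 hA0).trans h3
  -- notation-free abbreviations
  set a := ω.expect (Finset.Icc (1 : Site 1) (ℓ : Site 1))
    (twistOp fun x : ↥(Finset.Icc (1 : Site 1) (ℓ : Site 1)) =>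
      2 * Real.pi * ((x : Site 1) 0 : ℝ) / ℓ) with ha
  set w : ℝ → ℂ := fun α => ω.expect (Finset.Icc (1 : Site 1) (ℓ : Site 1))
    (twistOp fun _ : ↥(Finset.Icc (1 : Site 1) (ℓ : Site 1)) => α) with hw
  -- Step 1: the twist and the rotations are near-eigenvectors
  have haK : 1 - ‖a‖ ^ 2 ≤ 1 / 4 := by
    have h := gap_mul_le_twistU ℓ hgap hU hℓ1
    rw [← ha] at h
    have : γ * (1 - ‖a‖ ^ 2) ≤ γ * (1 / 4) := h.trans (by linarith [hK])
    exact le_of_mul_le_mul_left this hγ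
  have hwK : ∀ α : ℝ, |α| ≤ 2 * Real.pi / ℓ → 1 - ‖w α‖ ^ 2 ≤ 1 / 4 := by
    intro α hα
    have h := gap_mul_le_twistW ℓ hgap hU hα
    have : γ * (1 - ‖w α‖ ^ 2) ≤ γ * (1 / 4) := h.trans (by linarith [hK])
    exact le_of_mul_le_mul_left this hγ
  -- Step 2: the twist/translation identity and Cauchy–Schwarz give `re ω(W_{-2π/ℓ}) > 0`
  set α₀ : ℝ := -(2 * Real.pi / ℓ) with hα₀
  have hre_pos : 0 < (w α₀).re := by
    have hge := re_expect_twistU_translate_ge (J := J) ℓ hU hω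
    rw [conjTranspose_twistU_mul_translate n ℓ hℓ1, ω.compatible, ← ha] at hge
    have hsqrt : √(1 - ‖a‖ ^ 2) ≤ 1 / 2 := by
      rw [show (1 / 2 : ℝ) = √(1 / 4) by
        rw [show (1 / 4 : ℝ) = (1 / 2) ^ 2 by norm_num, Real.sqrt_sq (by norm_num)]]
      exact Real.sqrt_le_sqrt haK
    have : (3 : ℝ) / 4 - 1 / 2 ≤ (w α₀).re := by
      refine le_trans ?_ hge
      linarith
    linarith
  -- Step 3: reality (flip symmetry), continuity and the intermediate value theorem
  set g : ℝ → ℂ := fun α => Complex.exp (I * ((n : ℝ) * ℓ * α / 2 : ℝ)) * w α with hg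
  have hg_real : ∀ α, g α = ((g α).re : ℂ) := fun α =>
    (Complex.conj_eq_iff_re.1 (conj_expect_twistW (J := J) ℓ hU hω α)).symm ▸ rfl
  have hg_cont : Continuous g := by
    refine Continuous.mul ?_ (ω.continuous_expect_twistW _)
    fun_prop
  have hg0 : g 0 = 1 := by
    simp only [hg, hw]
    rw [mul_zero, zero_div, Complex.ofReal_zero, mul_zero, Complex.exp_zero, one_mul,
      show (fun _ : ↥(Finset.Icc (1 : Site 1) (ℓ : Site 1)) => (0 : ℝ)) = 0 from rfl, twistOp_zero,
      ω.expect_one]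
  have hg_norm : ∀ α, ‖g α‖ = ‖w α‖ := fun α => by
    simp only [hg]
    rw [norm_mul, mul_comm I, Complex.norm_exp_ofReal_mul_I, one_mul]
  -- `g` has no zero on `[α₀, 0]`
  have hg_ne : ∀ α ∈ Set.Icc α₀ 0, (g α).re ≠ 0 := by
    intro α hα h0
    have hαabs : |α| ≤ 2 * Real.pi / ℓ := by
      rw [abs_le]; constructor <;> linarith [hα.1, hα.2, hα₀]
    have hw0 : ‖w α‖ = 0 := by rw [← hg_norm, hg_real α, h0, Complex.ofReal_zero, norm_zero]
    have := hwK α hαabs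
    rw [hw0] at this
    norm_num at this
  -- hence `g(α₀) > 0` by the intermediate value theorem
  have hgα₀ : 0 < (g α₀).re := by
    by_contra hle'
    have hle := not_lt.1 hle'
    have hα₀0 : α₀ ≤ 0 := by rw [hα₀]; exact neg_nonpos.2 (by positivity)
    have hcont : ContinuousOn (fun α => (g α).re) (Set.Icc α₀ 0) :=
      (Complex.continuous_re.comp hg_cont).continuousOn
    have hmem : (0 : ℝ) ∈ Set.Icc ((fun α => (g α).re) α₀) ((fun α => (g α).re) 0) := by
      simp only [hg0, Complex.one_re]
      exact ⟨hle, zero_le_one⟩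
    obtain ⟨c, hc, hc0⟩ := intermediate_value_Icc hα₀0 hcont hmem
    exact hg_ne c hc hc0
  -- but `e^{inℓα₀/2} = e^{-iπn} = -1`: `ω(W_{α₀}) = -g(α₀) < 0`, contradicting Step 2
  have hphase : Complex.exp (I * ((n : ℝ) * ℓ * α₀ / 2 : ℝ)) = -1 := by
    have hℓπ : (ℓ : ℝ) * (2 * Real.pi / ℓ) = 2 * Real.pi := by field_simp
    have hr : (n : ℝ) * ℓ * α₀ / 2 = -((n : ℝ) * Real.pi) := by
      rw [hα₀]
      calc (n : ℝ) * ℓ * -(2 * Real.pi / ℓ) / 2 = -((n : ℝ) * ((ℓ : ℝ) * (2 * Real.pi / ℓ))) / 2 := by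
            ring
        _ = -((n : ℝ) * Real.pi) := by rw [hℓπ]; ring
    have h1 : I * (((n : ℝ) * ℓ * α₀ / 2 : ℝ) : ℂ) = -((n : ℂ) * (Real.pi * I)) := by
      rw [hr]; push_cast; ring
    rw [h1, Complex.exp_neg, exp_pi_mul_I_odd hn, inv_neg, inv_one]
  have hwg : w α₀ = -g α₀ := by
    simp only [hg]
    rw [hphase, neg_one_mul, neg_neg]
  have : (w α₀).re = -(g α₀).re := by rw [hwg, Complex.neg_re]
  linarith

end Literature.MathematicalPhysics.QuantumLattice
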